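import Literature.Computability.AlgebraicComplexity.BILPS19RectangularDesignEquationsProofs
import Literature.Computability.AlgebraicComplexity.BILPS19LatinRectangleConditionProofs
import Literature.Barriers.ValiantsHypothesis.NotViaSaturationsAlonTarsiDrisko
import Mathlib.LinearAlgebra.Matrix.MvPolynomial
import HarnessLib

/-!
# The Latin-rectangle condition `LRC(α, β)` of BILPS 2019 is Kumar's design polynomial:
# `LRC(β, β) ⇔` Alon–Tarsi, `LRC(β, β) ⇒ LRC(α, β)` (Kumar), hence `LRC(α, β)` and BILPS Thm 27
# UNCONDITIONALLY for every even `β ≤ 24` and `β = p ± 1`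

Bläser–Ikenmeyer–Lysikov–Pandey–Schreyer, *Variety membership testing, algebraic natural proofs, and
geometric complexity theory*, arXiv:1911.02534 (SODA 2021), §7.3 (held text
`paper:arxiv-1911.02534` p0026:L8–33). Conjecture 26 = `LRC(α, β)` ("Choose a set `𝒰` of `β` many
vectors in `ℂ^α` generically. Then `∑_L det(L) ≠ 0`, where the sum is over all Latin Rectangles for
`𝒰`") is the HYPOTHESIS of their Thm 27 (tree: the named fact `BILPS2019_thm27`, DISCHARGED as
`BILPS2019_thm27_holds`, with `latinRectangleCondition k m := latinRectSumPoly k m ≠ 0`). After the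
conjecture the source records (p0026:L28–33): "`LRC(β,β)` can be easily seen to be equivalent to the
Alon-Tarsi conjecture [AT:92] … known to be true for `β ∈ {p+1, p-1 ∣ p an odd prime}`, in
particular for all even `2 ≤ β ≤ 24` [Dri:98, Gly:10]. `LRC(β,β)` implies `LRC(α,β)` for `α ≤ β`,
as was shown by S. Kumar as part of his work on geometric complexity theory [Kum:15]."

This theorem-only file PROVES those printed sentences in the tree's vocabulary, by identifying the
BILPS polynomial `∑_L det(L)` with the tree's **design polynomial** of Kumar
(`Kumar2015.designPoly`, file `KumarLatinRectangles.lean`, Kumar 2015 §5), whose multilinear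
coefficient is the sum of squares `∑_𝒜 (♯L⁺_𝒜 − ♯L⁻_𝒜)²` of signed Latin-rectangle counts
(`Kumar2015.coeff_allOnes_designPoly_eq_sum_sq`, Kumar Prop. 5.2):

* `designPoly_eq_latinRectSumPoly` — **`∑_L det(L) = designPoly α β`** as integer polynomials in the
  coordinates `X_{(v,a)}` of `u_1, …, u_β` (expand each column determinant by Leibniz; arrays whose
  rows are permutations but with a repeated column entry have a column determinant with two equal
  columns, hence contribute `0`). Hence `latinRectangleCondition_iff_designPoly_ne_zero`.
* `latinRectSumPoly_eq_sum_pattern` — grouping Latin rectangles by their PATTERN (Kumar Def. 4.1):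
  `∑_L det(L) = ∑_𝒜 (♯L⁺_𝒜 − ♯L⁻_𝒜) · ∏_j Δ_{𝒜^j}(U)`, `Δ_S` the maximal minor of `U = (u_1 | ⋯ | u_β)`
  on the columns `S` in increasing order; so `LRC(α, β) ⇔ some pattern of size (α, β) has
  ♯L⁺_𝒜 ≠ ♯L⁻_𝒜` (`latinRectangleCondition_iff_exists_signedCount_ne_zero`; "⇐" is the sum of
  squares, "⇒" the pattern expansion).
* `latinRectangleCondition_self_iff_alonTarsi` — **`LRC(β, β) ⇔ AlonTarsiConjecture β`** (for a
  Latin square every column determinant is `± det U`, so `∑_L det(L) = (♯CELS − ♯COLS)(β) · det(U)^β`,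
  `latinRectSumPoly_self`; then Huang–Rota `latinColCount_ne_zero_iff`).
* `latinRectangleCondition_anti` — `LRC(α', β) ⇒ LRC(α, β)` for `α ≤ α'` (Kumar's row deletion,
  Lemma 4.2 = tree `signedCount_succ_eq_zero`); in particular **[Kum:15] as quoted: `LRC(β, β) ⇒
  LRC(α, β)`** (`latinRectangleCondition_of_self`), and `AlonTarsiConjecture β ⇒ LRC(α, β)` for all
  `α ≤ β` (`latinRectangleCondition_of_alonTarsi`).
* UNCONDITIONAL instances from the tree's Alon–Tarsi THEOREMS (`Drisko1997_AlonTarsi_holds`,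
  `Glynn2010_AlonTarsi_holds`, `alonTarsi_of_even_le_24_holds`): `LRC(α, β)` for every `α ≤ β` with
  `β` even, `2 ≤ β ≤ 24` (`latinRectangleCondition_of_even_le_24`), or `β = p ± 1`, `p` an odd prime
  (`latinRectangleCondition_prime_add_one` / `_prime_sub_one`).
* Consequently **BILPS Thm 27 with its Latin-rectangle hypothesis DISCHARGED** in those ranges:
  `BILPS2019_thm27_of_alonTarsi` (conditional only on `AlonTarsiConjecture m`),
  `BILPS2019_thm27_of_even_le_24`, `BILPS2019_thm27_prime_add_one`, `BILPS2019_thm27_prime_sub_one`: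
  for `m ≤ n`, `kr < m`, `kr < n`, `k ≤ m` and such `m`, the minrank variety `𝓜_r ⊆ F^{k×m×n}` has a
  nonzero homogeneous equation of degree `km` (algebraically closed `F` of characteristic `0`).

Together with the degenerate shapes (`latinRectangleCondition_zero_right`: `LRC(α, 0)`;
`not_latinRectangleCondition_of_lt`: `¬ LRC(α, β)` for `1 ≤ β < α`) and the sibling file
`BILPS19LatinRectangleConditionProofs.lean` (`LRC(1, β)` always, `LRC(2, β) ⇔ β` even, `¬ LRC(α, β)`
for `α ≥ 2` and odd `β`) this decides the typed hypothesis `latinRectangleCondition α β` for every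
`α` and every `β ≤ 25`; the first shape left open in the tree is `LRC(α, 26)`, `3 ≤ α ≤ 26` (print:
`α ≤ 5` for all even `β` follows from work on Foulkes' conjecture [MN:05, McK:08, CIM:15] — not
formalised; `LRC(26, 26)` = Alon–Tarsi for `26`, open in print).

Faithfulness sheet (typed-vs-printed, p0026:L28–33): "equivalent to the Alon–Tarsi conjecture" =
`latinRectangleCondition_self_iff_alonTarsi` FAITHFUL (the tree's `AlonTarsiConjecture n` is the
row-and-column signed count of BHI 2017 §1.1, bridged to the column count by the tree's Huang–Rota
lemma); "[Kum:15]" = `latinRectangleCondition_of_self` FAITHFUL; "in particular for all even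
`2 ≤ β ≤ 24`" = `latinRectangleCondition_of_even_le_24` FAITHFUL (via the tree's Drisko/Glynn
theorems); nothing STRONGER than print is asserted; no new definitions, no named facts. Honest
framing (val-lit): equations for the MINRANK varieties; nothing here bears on `VP ≠ VNP`.

## References
* [BlaserIkenmeyerLysikovPandeySchreyer2019] arXiv:1911.02534, §7.3, Conj. 26, the remarks after
  it, Thm. 27 (p0026:L8–40).
* [Kumar2015] S. Kumar, *A study of the representations supported by the orbit closure of the
  determinant*, Compositio Math. 151 (2015), Def. 4.1, Lemma 4.2, Prop. 5.2, Thm. 5.6.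
* [Drisko1997] A. A. Drisko, Adv. Math. 128 (1997), Thm. 9; [Glynn2010AlonTarsi] D. G. Glynn, SIAM
  J. Discrete Math. 24 (2010), Thm. 3.2, Cor. 3.4; [BurgisserHuttenhainIkenmeyer2017] §1.1
  (the tree's `AlonTarsiConjecture`).
-/

noncomputable section

open MvPolynomial Matrix Finset Equiv

namespace Literature.Computability.AlgebraicComplexity

namespace BILPS2019

open Kumar2015 Literature.Barriers.ValiantsHypothesis

variable {α β : ℕ}

/-! ## The column determinant by Leibniz, and `∑_L det(L) =` Kumar's design polynomial -/

/-- Leibniz expansion of one column determinant `det(u_{c(1)}, …, u_{c(α)})` in the coordinates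
`X_{(v,a)}`: `∑_τ sgn(τ) ∏_p X_{(c p, τ p)}`. [cite: BlaserIkenmeyerLysikovPandeySchreyer2019, §7.3 (column-determinant)] -/
theorem det_of_X_eq_sum_perm (c : Fin α → Fin β) :
    Matrix.det (Matrix.of fun a p : Fin α => (X (c p, a) : MvPolynomial (Fin β × Fin α) ℤ)) =
      ∑ τ : Perm (Fin α), C ((Perm.sign τ : ℤˣ) : ℤ) * ∏ p, X (c p, τ p) := by
  rw [Matrix.det_apply']
  refine Finset.sum_congr rfl fun τ _ => ?_
  congr 1

/-- For fixed row permutations `π` (array `rowsOf π`: row `p` is `π_p⁻¹`), the `σ`-sum of the design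
polynomial is the column-determinant product `det(rowsOf π)`.
[cite: Kumar2015, Prop. 5.2 (proof, A(σ))] -/
theorem sum_sigma_designTerm_eq_colDetPoly (π : Fin α → Perm (Fin β)) :
    (∑ σ : Fin β → Perm (Fin α), C ((∏ j, Perm.sign (σ j) : ℤˣ) : ℤ) *
        ∏ p : Fin α, ∏ r : Fin β, (X (r, σ (π p r) p) : MvPolynomial (Fin β × Fin α) ℤ)) =
      colDetPoly (rowsOf π) := by
  have hterm : ∀ σ : Fin β → Perm (Fin α),
      C ((∏ j, Perm.sign (σ j) : ℤˣ) : ℤ) *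
          ∏ p : Fin α, ∏ r : Fin β, (X (r, σ (π p r) p) : MvPolynomial (Fin β × Fin α) ℤ) =
        ∏ j : Fin β, (C ((Perm.sign (σ j) : ℤˣ) : ℤ) *
          ∏ p : Fin α, (X (rowsOf π p j, σ j p) : MvPolynomial (Fin β × Fin α) ℤ)) := by
    intro σ
    rw [Finset.prod_mul_distrib, Units.coe_prod, map_prod]
    congr 1
    calc (∏ p : Fin α, ∏ r : Fin β, (X (r, σ (π p r) p) : MvPolynomial (Fin β × Fin α) ℤ))
        = ∏ p : Fin α, ∏ j : Fin β, (X (rowsOf π p j, σ j p) : MvPolynomial (Fin β × Fin α) ℤ) := by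
          refine Finset.prod_congr rfl fun p _ => ?_
          rw [← Equiv.prod_comp (π p)
            (fun j => (X (rowsOf π p j, σ j p) : MvPolynomial (Fin β × Fin α) ℤ))]
          refine Finset.prod_congr rfl fun r _ => ?_
          simp only [rowsOf, Equiv.symm_apply_apply]
      _ = ∏ j : Fin β, ∏ p : Fin α, (X (rowsOf π p j, σ j p) : MvPolynomial (Fin β × Fin α) ℤ) :=
          Finset.prod_comm
  have hcol : colDetPoly (rowsOf π) = ∏ j : Fin β, ∑ τ : Perm (Fin α),
      C ((Perm.sign τ : ℤˣ) : ℤ) *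
        ∏ p : Fin α, (X (rowsOf π p j, τ p) : MvPolynomial (Fin β × Fin α) ℤ) := by
    unfold colDetPoly
    exact Finset.prod_congr rfl fun j _ => det_of_X_eq_sum_perm _
  rw [hcol, Fintype.prod_sum]
  exact Finset.sum_congr rfl fun σ _ => hterm σ

/-- **`∑_L det(L)` is Kumar's design polynomial**: `designPoly α β = latinRectSumPoly α β` in
`ℤ[X_{(v,a)} : v < β, a < α]`. Proof: swap the two sums of the design polynomial, identify the inner
sum with `det(rowsOf π)` (`sum_sigma_designTerm_eq_colDetPoly`), drop the arrays with a repeated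
column entry (a column determinant with two equal columns; Kumar's (e18) in polynomial form), and
re-index the column-injective `π` by Latin rectangles (`rowsOf`/`permsOf`).
[cite: Kumar2015, Prop. 5.2] [cite: BlaserIkenmeyerLysikovPandeySchreyer2019, §7.3 (Conj. 26)] -/
theorem designPoly_eq_latinRectSumPoly (α β : ℕ) : designPoly α β = latinRectSumPoly α β := by
  classical
  unfold designPoly
  rw [Finset.sum_comm]
  rw [Finset.sum_congr rfl fun π _ => sum_sigma_designTerm_eq_colDetPoly π]
  rw [← Finset.sum_filter_add_sum_filter_not univ (fun π : Fin α → Perm (Fin β) => ColInj π)]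
  have h0 : ∑ π ∈ univ.filter (fun π : Fin α → Perm (Fin β) => ¬ ColInj π),
      colDetPoly (rowsOf π) = 0 := by
    refine Finset.sum_eq_zero fun π hπ => ?_
    have hπ' : ¬ ColInj π := (Finset.mem_filter.mp hπ).2
    simp only [ColInj, not_forall] at hπ'
    obtain ⟨j, hj⟩ := hπ'
    exact BILPS2019Thm27.colDetPoly_eq_zero_of_not_injective (rowsOf π) j hj
  rw [h0, add_zero]
  unfold latinRectSumPoly
  refine Finset.sum_nbij' rowsOf permsOf (fun π hπ => ?_) (fun R hR => ?_)
    (fun π _ => permsOf_rowsOf π) (fun R hR => ?_) (fun _ _ => rfl)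
  · rw [Finset.mem_filter] at hπ
    exact Finset.mem_filter.mpr ⟨Finset.mem_univ _, isLatinRect_rowsOf hπ.2⟩
  · rw [Finset.mem_filter] at hR ⊢
    refine ⟨Finset.mem_univ _, fun j => ?_⟩
    have := hR.2.2 j
    rw [← rowsOf_permsOf hR.2] at this
    exact this
  · rw [Finset.mem_filter] at hR
    exact rowsOf_permsOf hR.2

/-- `∑_L det(L) = designPoly α β` (the symmetric form). [cite: Kumar2015, Prop. 5.2] -/
theorem latinRectSumPoly_eq_designPoly (α β : ℕ) : latinRectSumPoly α β = designPoly α β :=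
  (designPoly_eq_latinRectSumPoly α β).symm

/-- **`LRC(α, β) ⇔` the design polynomial of size `(α, β)` is nonzero.**
[cite: BlaserIkenmeyerLysikovPandeySchreyer2019, §7.3 (Conj. 26)] [cite: Kumar2015, Thm. 5.6] -/
theorem latinRectangleCondition_iff_designPoly_ne_zero :
    latinRectangleCondition α β ↔ designPoly α β ≠ 0 := by
  unfold latinRectangleCondition
  rw [latinRectSumPoly_eq_designPoly]

/-- A pattern with `♯L⁺_𝒜 ≠ ♯L⁻_𝒜` forces `LRC(α, β)` (its square sits in the multilinear coefficient
of `∑_L det(L)`). [cite: Kumar2015, Cor. 5.3] -/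
theorem latinRectangleCondition_of_signedCount_ne_zero {A : Fin β → Finset (Fin β)}
    (hA : signedCount α β A ≠ 0) : latinRectangleCondition α β :=
  latinRectangleCondition_iff_designPoly_ne_zero.mpr (designPoly_ne_zero hA)

/-- `♯CELS(β) ≠ ♯COLS(β)` (column Latin square conjecture for `β`) gives `LRC(α, β)` for every
`α ≤ β` (Kumar Lemma 4.2 + Prop. 5.2). [cite: Kumar2015, Thm. 5.6 ("In particular")] -/
theorem latinRectangleCondition_of_latinColCount_ne_zero (hαβ : α ≤ β) (h : latinColCount β ≠ 0) :
    latinRectangleCondition α β :=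
  latinRectangleCondition_iff_designPoly_ne_zero.mpr (designPoly_ne_zero_of_latinColCount_ne_zero h hαβ)

/-- **Alon–Tarsi for `β` implies `LRC(α, β)` for every `α ≤ β`** ("`LRC(β,β)` … equivalent to the
Alon-Tarsi conjecture … `LRC(β,β)` implies `LRC(α,β)` for `α ≤ β` [Kum:15]", p0026:L30–33).
[cite: BlaserIkenmeyerLysikovPandeySchreyer2019, §7.3 (remarks after Conj. 26)] [cite: Kumar2015, Thm. 5.6] -/
theorem latinRectangleCondition_of_alonTarsi (hαβ : α ≤ β) (h : AlonTarsiConjecture β) :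
    latinRectangleCondition α β :=
  latinRectangleCondition_of_latinColCount_ne_zero hαβ ((latinColCount_ne_zero_iff β).mpr h)

/-! ## The square case: `LRC(β, β) ⇔` Alon–Tarsi -/

/-- Permuting the vectors of a full column: `det(u_{σ(1)}, …, u_{σ(β)}) = sgn(σ) · det(u_1, …, u_β)`.
[folklore] -/
private theorem det_of_X_perm (σ : Perm (Fin β)) :
    Matrix.det (Matrix.of fun a p : Fin β => (X (σ p, a) : MvPolynomial (Fin β × Fin β) ℤ)) =
      C ((Perm.sign σ : ℤˣ) : ℤ) *
        Matrix.det (Matrix.of fun a v : Fin β => (X (v, a) : MvPolynomial (Fin β × Fin β) ℤ)) := by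
  have hM : (Matrix.of fun a p : Fin β => (X (σ p, a) : MvPolynomial (Fin β × Fin β) ℤ)) =
      (Matrix.of fun a v : Fin β => (X (v, a) : MvPolynomial (Fin β × Fin β) ℤ)).submatrix id σ := by
    ext a p
    rfl
  rw [hM, Matrix.det_permute']
  congr 1

/-- The generic matrix `(X_{(v,a)})_{a,v}` has nonzero determinant (it is the transpose of Mathlib's
`Matrix.mvPolynomialX`). [folklore] -/
private theorem det_of_X_ne_zero (β : ℕ) :
    Matrix.det (Matrix.of fun a v : Fin β => (X (v, a) : MvPolynomial (Fin β × Fin β) ℤ)) ≠ 0 := by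
  have hM : (Matrix.of fun a v : Fin β => (X (v, a) : MvPolynomial (Fin β × Fin β) ℤ)) =
      (Matrix.mvPolynomialX (Fin β) (Fin β) ℤ).transpose := by
    ext a v
    rfl
  rw [hM, Matrix.det_transpose]
  exact Matrix.det_mvPolynomialX_ne_zero (Fin β) ℤ

/-- For a Latin SQUARE `R`, `det(R) = ε_c(R) · det(U)^β`: every column is a permutation `σ_j` of all
the vectors, its determinant is `sgn(σ_j) det U`, and `sgn(σ_j) = ε(R^j)` is Kumar's column sign.
[cite: BlaserIkenmeyerLysikovPandeySchreyer2019, §7.3 ("Note that if α ≥ β, then each column contains each vector exactly once")] -/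
theorem colDetPoly_of_isLatinRect_self {R : Fin β → Fin β → Fin β} (hR : IsLatinRect R) :
    colDetPoly R = C ((rectColSign R : ℤˣ) : ℤ) *
      Matrix.det (Matrix.of fun a v : Fin β => (X (v, a) : MvPolynomial (Fin β × Fin β) ℤ)) ^ β := by
  have hcol : ∀ j : Fin β,
      Matrix.det (Matrix.of fun a p : Fin β => (X (R p j, a) : MvPolynomial (Fin β × Fin β) ℤ)) =
        C ((seqSign (fun p => R p j) : ℤˣ) : ℤ) *
          Matrix.det (Matrix.of fun a v : Fin β => (X (v, a) : MvPolynomial (Fin β × Fin β) ℤ)) := by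
    intro j
    have hb : Function.Bijective fun p => R p j := Finite.injective_iff_bijective.mp (hR.2 j)
    have hσ : (fun p => R p j) = ⇑(Equiv.ofBijective _ hb) := rfl
    rw [hσ, seqSign_coe_perm, ← det_of_X_perm (Equiv.ofBijective _ hb)]
    rfl
  unfold colDetPoly rectColSign
  rw [Finset.prod_congr rfl fun j _ => hcol j, Finset.prod_mul_distrib, Finset.prod_const,
    Finset.card_univ, Fintype.card_fin, Units.coe_prod, map_prod]

/-- **`∑_L det(L)` for squares**: `latinRectSumPoly β β = (♯CELS(β) − ♯COLS(β)) · det(U)^β`.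
[cite: BlaserIkenmeyerLysikovPandeySchreyer2019, §7.3 (remarks after Conj. 26: "LRC(β,β) … equivalent to the Alon-Tarsi conjecture")] -/
theorem latinRectSumPoly_self (β : ℕ) :
    latinRectSumPoly β β = C (latinColCount β) *
      Matrix.det (Matrix.of fun a v : Fin β => (X (v, a) : MvPolynomial (Fin β × Fin β) ℤ)) ^ β := by
  classical
  unfold latinRectSumPoly latinColCount
  rw [map_sum, Finset.sum_mul]
  refine Finset.sum_congr ?_ fun R hR => ?_
  · ext R
    simp only [Finset.mem_filter, Finset.mem_univ, true_and]
  · exact colDetPoly_of_isLatinRect_self (Finset.mem_filter.mp hR).2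

/-- `LRC(β, β) ⇔ ♯CELS(β) ≠ ♯COLS(β)` (column Latin square conjecture for `β`).
[cite: BlaserIkenmeyerLysikovPandeySchreyer2019, §7.3 (remarks after Conj. 26)] [cite: Kumar2015, Rem. 4.5] -/
theorem latinRectangleCondition_self_iff_latinColCount_ne_zero (β : ℕ) :
    latinRectangleCondition β β ↔ latinColCount β ≠ 0 := by
  unfold latinRectangleCondition
  rw [latinRectSumPoly_self, Ne, mul_eq_zero, not_or, C_eq_zero]
  exact ⟨fun h => h.1, fun h => ⟨h, pow_ne_zero _ (det_of_X_ne_zero β)⟩⟩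

/-- **`LRC(β, β) ⇔` the Alon–Tarsi conjecture for `β`** ("can be easily seen to be equivalent to
the Alon-Tarsi conjecture [AT:92], which is equivalent to the Huang-Rota conjecture [HR:94]",
p0026:L30). [cite: BlaserIkenmeyerLysikovPandeySchreyer2019, §7.3 (remarks after Conj. 26)] -/
theorem latinRectangleCondition_self_iff_alonTarsi (β : ℕ) :
    latinRectangleCondition β β ↔ AlonTarsiConjecture β :=
  (latinRectangleCondition_self_iff_latinColCount_ne_zero β).trans (latinColCount_ne_zero_iff β)

/-! ## Grouping by patterns: `LRC(α, β) ⇔` some pattern has `♯L⁺_𝒜 ≠ ♯L⁻_𝒜`; monotonicity in `α` -/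

/-- A strictly increasing sequence has no inversions: its sign is `+1`. [folklore] -/
private theorem seqSign_eq_one_of_strictMono {ι : Type*} [LinearOrder ι] {g : Fin α → ι}
    (hg : StrictMono g) : seqSign g = 1 := by
  unfold seqSign
  refine Finset.prod_eq_one fun p _ => Finset.prod_eq_one fun p' hp' => ?_
  rw [if_pos (hg (Finset.mem_Ioi.mp hp'))]

/-- **Column determinant versus the sorted minor.** For an injective column `c` (labels
`c(1), …, c(α)`, set of labels `S = im c`, `|S| = α`): `det(u_{c(1)}, …, u_{c(α)}) = ε(c) · Δ_S(U)`,
where `Δ_S` is the maximal minor of `U` on the columns `S` taken in increasing order and `ε(c)` is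
Kumar's sign of the sequence `c`. [cite: Kumar2015, Def. 4.1 (ε(A^q))] -/
theorem det_of_X_eq_seqSign_mul_minor {c : Fin α → Fin β} (hc : Function.Injective c)
    (hS : (univ.image c).card = α) :
    Matrix.det (Matrix.of fun a p : Fin α => (X (c p, a) : MvPolynomial (Fin β × Fin α) ℤ)) =
      C ((seqSign c : ℤˣ) : ℤ) *
        Matrix.det (Matrix.of fun a q : Fin α =>
          (X ((univ.image c).orderEmbOfFin hS q, a) : MvPolynomial (Fin β × Fin α) ℤ)) := by
  classical
  set S : Finset (Fin β) := univ.image c with hSdef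
  have hmem : ∀ p, c p ∈ S := fun p => Finset.mem_image_of_mem c (Finset.mem_univ p)
  -- the reordering permutation `τ` with `c = e ∘ τ`, `e` the increasing enumeration of `S`
  let t : Fin α → Fin α := fun p => (S.orderIsoOfFin hS).symm ⟨c p, hmem p⟩
  have ht : Function.Injective t := by
    intro p p' h
    have h' := congrArg (fun q => ((S.orderIsoOfFin hS q : S) : Fin β)) h
    simp only [t, OrderIso.apply_symm_apply] at h'
    exact hc h'
  let τ : Perm (Fin α) := Equiv.ofBijective t (Finite.injective_iff_bijective.mp ht)
  have heτ : ∀ p, S.orderEmbOfFin hS (τ p) = c p := by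
    intro p
    change S.orderEmbOfFin hS (t p) = c p
    rw [← Finset.coe_orderIsoOfFin_apply]
    simp only [t, OrderIso.apply_symm_apply]
  have hce : c = (fun q => S.orderEmbOfFin hS q) ∘ τ := funext fun p => (heτ p).symm
  -- the determinant: permute the columns of the sorted minor
  have hM : (Matrix.of fun a p : Fin α => (X (c p, a) : MvPolynomial (Fin β × Fin α) ℤ)) =
      (Matrix.of fun a q : Fin α =>
        (X (S.orderEmbOfFin hS q, a) : MvPolynomial (Fin β × Fin α) ℤ)).submatrix id τ := by
    ext a p
    simp only [Matrix.submatrix_apply, Matrix.of_apply, id, heτ]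
  rw [hM, Matrix.det_permute']
  -- the sign: `ε(c) = ε(e ∘ τ) = sgn τ · ε(e) = sgn τ`
  have hsign : seqSign c = Perm.sign τ := by
    rw [hce, seqSign_comp_perm (S.orderEmbOfFin hS).injective τ,
      seqSign_eq_one_of_strictMono (S.orderEmbOfFin hS).strictMono, mul_one]
  rw [hsign]
  congr 1

/-- The pattern of a Latin rectangle has columns of size `α`. [cite: Kumar2015, Def. 4.1] -/
theorem card_pattern_of_isLatinRect {R : Fin α → Fin β → Fin β} (hR : IsLatinRect R) (j : Fin β) :
    (pattern R j).card = α := by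
  classical
  unfold pattern
  rw [Finset.card_image_of_injective _ (hR.2 j), Finset.card_univ, Fintype.card_fin]

/-- **`det(L) = ε_c(L) · ∏_j Δ_{𝒜^j}(U)`** for a Latin rectangle `L` with pattern `𝒜`: the
column-determinant product is Kumar's column sign times the product of the sorted maximal minors
selected by the pattern. [cite: Kumar2015, Def. 4.1] [cite: BlaserIkenmeyerLysikovPandeySchreyer2019, §7.3 (column-determinant)] -/
theorem colDetPoly_eq_rectColSign_mul_minors {R : Fin α → Fin β → Fin β} (hR : IsLatinRect R) :
    colDetPoly R = C ((rectColSign R : ℤˣ) : ℤ) *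
      ∏ j : Fin β, (if h : (pattern R j).card = α then
        Matrix.det (Matrix.of fun a q : Fin α =>
          (X ((pattern R j).orderEmbOfFin h q, a) : MvPolynomial (Fin β × Fin α) ℤ)) else 0) := by
  classical
  unfold colDetPoly rectColSign
  rw [Units.coe_prod, map_prod, ← Finset.prod_mul_distrib]
  refine Finset.prod_congr rfl fun j _ => ?_
  rw [dif_pos (card_pattern_of_isLatinRect hR j)]
  exact det_of_X_eq_seqSign_mul_minor (hR.2 j) (card_pattern_of_isLatinRect hR j)

/-- **Pattern expansion of `∑_L det(L)`**: `∑_L det(L) = ∑_𝒜 (♯L⁺_𝒜 − ♯L⁻_𝒜) · ∏_j Δ_{𝒜^j}(U)`, the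
sum over all tuples `𝒜` of subsets (non-patterns count `0`).
[cite: Kumar2015, Def. 4.1 and Lemma 4.2 (signed counts)] [cite: BlaserIkenmeyerLysikovPandeySchreyer2019, §7.3 (Conj. 26)] -/
theorem latinRectSumPoly_eq_sum_pattern (α β : ℕ) :
    latinRectSumPoly α β = ∑ A : Fin β → Finset (Fin β), C (signedCount α β A) *
      ∏ j : Fin β, (if h : (A j).card = α then
        Matrix.det (Matrix.of fun a q : Fin α =>
          (X ((A j).orderEmbOfFin h q, a) : MvPolynomial (Fin β × Fin α) ℤ)) else 0) := by
  classical
  unfold latinRectSumPoly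
  rw [← Finset.sum_fiberwise_of_maps_to (t := (univ : Finset (Fin β → Finset (Fin β))))
    (g := pattern) (fun _ _ => Finset.mem_univ _)]
  refine Finset.sum_congr rfl fun A _ => ?_
  unfold signedCount
  rw [map_sum, Finset.sum_mul, Finset.filter_filter]
  refine Finset.sum_congr ?_ fun R hR => ?_
  · ext R
    simp only [Finset.mem_filter, Finset.mem_univ, true_and]
  · obtain ⟨hL, hP⟩ := (Finset.mem_filter.mp hR).2
    rw [colDetPoly_eq_rectColSign_mul_minors hL, hP]

/-- If every pattern of size `(α, β)` has `♯L⁺_𝒜 = ♯L⁻_𝒜` then `∑_L det(L) = 0`.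
[cite: Kumar2015, Lemma 4.2] -/
theorem latinRectSumPoly_eq_zero_of_forall_signedCount_eq_zero
    (h : ∀ A : Fin β → Finset (Fin β), signedCount α β A = 0) : latinRectSumPoly α β = 0 := by
  rw [latinRectSumPoly_eq_sum_pattern]
  exact Finset.sum_eq_zero fun A _ => by rw [h A, C_0, zero_mul]

/-- **`LRC(α, β) ⇔` some pattern `𝒜` of size `(α, β)` has `♯L⁺_𝒜 ≠ ♯L⁻_𝒜`** ("⇐": the square
`(♯L⁺_𝒜 − ♯L⁻_𝒜)²` occurs in the multilinear coefficient, Kumar Prop. 5.2; "⇒": the pattern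
expansion). [cite: Kumar2015, Prop. 5.2 and Lemma 4.2] [cite: BlaserIkenmeyerLysikovPandeySchreyer2019, §7.3 (Conj. 26)] -/
theorem latinRectangleCondition_iff_exists_signedCount_ne_zero :
    latinRectangleCondition α β ↔ ∃ A : Fin β → Finset (Fin β), signedCount α β A ≠ 0 := by
  refine ⟨fun h => ?_, fun ⟨A, hA⟩ => latinRectangleCondition_of_signedCount_ne_zero hA⟩
  by_contra hcon
  push Not at hcon
  exact h (latinRectSumPoly_eq_zero_of_forall_signedCount_eq_zero hcon)

/-- Deleting a row: `LRC(α + 1, β) ⇒ LRC(α, β)` (Kumar's Lemma 4.2: a pattern of size `(α+1, β)`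
with nonzero signed count leaves one of size `(α, β)`). [cite: Kumar2015, Lemma 4.2] -/
theorem latinRectangleCondition_of_succ (h : latinRectangleCondition (α + 1) β) :
    latinRectangleCondition α β := by
  obtain ⟨A, hA⟩ := latinRectangleCondition_iff_exists_signedCount_ne_zero.mp h
  by_contra hcon
  rw [latinRectangleCondition_iff_exists_signedCount_ne_zero, not_exists] at hcon
  exact hA (signedCount_succ_eq_zero (fun B => not_not.mp (hcon B)) A)

/-- **`LRC` is antitone in the number of rows**: `LRC(α', β) ⇒ LRC(α, β)` for `α ≤ α'`.
[cite: Kumar2015, Lemma 4.2] -/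
theorem latinRectangleCondition_anti {α α' β : ℕ} (hle : α ≤ α')
    (h : latinRectangleCondition α' β) : latinRectangleCondition α β := by
  induction α', hle using Nat.le_induction with
  | base => exact h
  | succ n _ ih => exact ih (latinRectangleCondition_of_succ h)

/-- **[Kum:15] as quoted in BILPS §7.3: "`LRC(β,β)` implies `LRC(α,β)` for `α ≤ β`"** (p0026:L32–33).
[cite: BlaserIkenmeyerLysikovPandeySchreyer2019, §7.3 (remarks after Conj. 26)] [cite: Kumar2015, Lemma 4.2 and Prop. 4.4] -/
theorem latinRectangleCondition_of_self (hαβ : α ≤ β) (h : latinRectangleCondition β β) :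
    latinRectangleCondition α β :=
  latinRectangleCondition_anti hαβ h

/-! ## Degenerate shapes: no columns, or more rows than vectors -/

/-- `LRC(α, 0)` holds for every `α`: with no columns there is exactly one (empty-column) array, it is
a Latin rectangle, and its column-determinant product is the empty product `1` (degenerate shape of
the typed hypothesis). [cite: BlaserIkenmeyerLysikovPandeySchreyer2019, §7.3 (Conj. 26; shape β = 0)] -/
theorem latinRectangleCondition_zero_right (α : ℕ) : latinRectangleCondition α 0 := by
  classical
  unfold latinRectangleCondition latinRectSumPoly
  have hall : ∀ R : Fin α → Fin 0 → Fin 0, Kumar2015.IsLatinRect R := fun R =>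
    ⟨fun p => ⟨fun a => a.elim0, fun a => a.elim0⟩, fun j => j.elim0⟩
  rw [Finset.filter_true_of_mem (fun R _ => hall R)]
  have h1 : ∀ R : Fin α → Fin 0 → Fin 0, colDetPoly R = 1 := fun R => by
    unfold colDetPoly
    exact Finset.prod_eq_one fun j _ => j.elim0
  rw [Finset.sum_congr rfl fun R _ => h1 R, Finset.sum_const, Finset.card_univ, nsmul_eq_mul,
    mul_one]
  exact_mod_cast Fintype.card_ne_zero

/-- For `1 ≤ β < α` there is no `α × β` Latin rectangle (a column would be an injection
`Fin α ↪ Fin β`), so `∑_L det(L) = 0` and `LRC(α, β)` FAILS: the condition is meaningful only for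
`α ≤ β` (as printed, "such that `α ≤ β`", p0026:L21). [cite: BlaserIkenmeyerLysikovPandeySchreyer2019, §7.3 (Conj. 26, "α ≤ β")] -/
theorem not_latinRectangleCondition_of_lt (h1 : 1 ≤ β) (h : β < α) :
    ¬ latinRectangleCondition α β := by
  classical
  unfold latinRectangleCondition latinRectSumPoly
  rw [not_not]
  refine Finset.sum_eq_zero fun R hR => ?_
  exfalso
  have hinj := (Finset.mem_filter.mp hR).2.2 ⟨0, h1⟩
  have := Fintype.card_le_of_injective _ hinj
  simp only [Fintype.card_fin] at this
  omega

/-! ## Unconditional instances (the tree's Alon–Tarsi theorems) -/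

/-- **`LRC(α, β)` for every `α ≤ β`, `β` even, `2 ≤ β ≤ 24`** ("in particular for all even
`2 ≤ β ≤ 24` [Dri:98, Gly:10]" combined with [Kum:15], p0026:L30–33) — UNCONDITIONAL, from the
tree's `alonTarsi_of_even_le_24_holds` (Drisko `p + 1`, Glynn `p − 1`).
[cite: BlaserIkenmeyerLysikovPandeySchreyer2019, §7.3 (remarks after Conj. 26)] [cite: Glynn2010AlonTarsi, Cor. 3.4] -/
theorem latinRectangleCondition_of_even_le_24 (hαβ : α ≤ β) (hβ : Even β) (h2 : 2 ≤ β)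
    (h24 : β ≤ 24) : latinRectangleCondition α β :=
  latinRectangleCondition_of_alonTarsi hαβ (alonTarsi_of_even_le_24_holds hβ h2 h24)

/-- `LRC(α, p + 1)` for `α ≤ p + 1`, `p` an odd prime (Drisko's case of Alon–Tarsi).
[cite: BlaserIkenmeyerLysikovPandeySchreyer2019, §7.3 (remarks after Conj. 26)] [cite: Drisko1997, Thm. 9] -/
theorem latinRectangleCondition_prime_add_one {p : ℕ} (hp : p.Prime) (hodd : Odd p)
    (hα : α ≤ p + 1) : latinRectangleCondition α (p + 1) :=
  latinRectangleCondition_of_alonTarsi hα (Drisko1997_AlonTarsi_holds p hp hodd)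

/-- `LRC(α, p - 1)` for `α ≤ p - 1`, `p` an odd prime (Glynn's case of Alon–Tarsi).
[cite: BlaserIkenmeyerLysikovPandeySchreyer2019, §7.3 (remarks after Conj. 26)] [cite: Glynn2010AlonTarsi, Thm. 3.2] -/
theorem latinRectangleCondition_prime_sub_one {p : ℕ} (hp : p.Prime) (hodd : Odd p)
    (hα : α ≤ p - 1) : latinRectangleCondition α (p - 1) :=
  latinRectangleCondition_of_alonTarsi hα (Glynn2010_AlonTarsi_holds p hp hodd)

end BILPS2019

/-! ## BILPS Thm 27 with the Latin-rectangle hypothesis discharged -/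

open BILPS2019 Literature.Barriers.ValiantsHypothesis

/-- **BILPS Thm 27 conditional only on Alon–Tarsi for `m`**: for `m ≤ n`, `kr < m`, `kr < n`,
`k ≤ m` and `AlonTarsiConjecture m`, the minrank variety `𝓜_r ⊆ F^{k×m×n}` (`F` algebraically
closed of characteristic `0`) has a nonzero homogeneous equation of degree `km` — the typed Thm 27
(`BILPS2019_thm27_holds`) fed with `latinRectangleCondition_of_alonTarsi`.
[cite: BlaserIkenmeyerLysikovPandeySchreyer2019, Thm. 27 and §7.3 (remarks after Conj. 26)] -/
theorem BILPS2019_thm27_of_alonTarsi (F : Type) [Field F] [IsAlgClosed F] [CharZero F]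
    (k m n r : ℕ) (hmn : m ≤ n) (hm : k * r < m) (hn : k * r < n) (hkm : k ≤ m)
    (hAT : AlonTarsiConjecture m) :
    ∃ f : MvPolynomial (Fin k × Fin m × Fin n) F, f ≠ 0 ∧ f.IsHomogeneous (k * m) ∧
      ∀ T ∈ (minrankSet F r : Set (Fin k → Fin m → Fin n → F)), eval (trilinearPt T) f = 0 :=
  BILPS2019_thm27_holds F k m n r hmn hm hn (latinRectangleCondition_of_alonTarsi hkm hAT)

/-- **BILPS Thm 27, UNCONDITIONAL for even `m ≤ 24`**: for `m ≤ n`, `kr < m`, `kr < n`, `k ≤ m`,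
`m` even and `m ≤ 24`, the minrank variety `𝓜_r ⊆ F^{k×m×n}` has a nonzero homogeneous equation of
degree `km` (`F` algebraically closed of characteristic `0`).
[cite: BlaserIkenmeyerLysikovPandeySchreyer2019, Thm. 27 and §7.3 (remarks after Conj. 26)] [cite: Glynn2010AlonTarsi, Cor. 3.4] -/
theorem BILPS2019_thm27_of_even_le_24 (F : Type) [Field F] [IsAlgClosed F] [CharZero F]
    (k m n r : ℕ) (hmn : m ≤ n) (hm : k * r < m) (hn : k * r < n) (hkm : k ≤ m)
    (heven : Even m) (h24 : m ≤ 24) :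
    ∃ f : MvPolynomial (Fin k × Fin m × Fin n) F, f ≠ 0 ∧ f.IsHomogeneous (k * m) ∧
      ∀ T ∈ (minrankSet F r : Set (Fin k → Fin m → Fin n → F)), eval (trilinearPt T) f = 0 := by
  have h2 : 2 ≤ m := by obtain ⟨t, rfl⟩ := heven; omega
  exact BILPS2019_thm27_holds F k m n r hmn hm hn
    (latinRectangleCondition_of_even_le_24 hkm heven h2 h24)

/-- BILPS Thm 27, unconditional for `m = p + 1`, `p` an odd prime.
[cite: BlaserIkenmeyerLysikovPandeySchreyer2019, Thm. 27 and §7.3 (remarks after Conj. 26)] [cite: Drisko1997, Thm. 9] -/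
theorem BILPS2019_thm27_prime_add_one (F : Type) [Field F] [IsAlgClosed F] [CharZero F]
    {p : ℕ} (hp : p.Prime) (hodd : Odd p) (k n r : ℕ) (hmn : p + 1 ≤ n) (hm : k * r < p + 1)
    (hn : k * r < n) (hkm : k ≤ p + 1) :
    ∃ f : MvPolynomial (Fin k × Fin (p + 1) × Fin n) F, f ≠ 0 ∧ f.IsHomogeneous (k * (p + 1)) ∧
      ∀ T ∈ (minrankSet F r : Set (Fin k → Fin (p + 1) → Fin n → F)),
        eval (trilinearPt T) f = 0 :=
  BILPS2019_thm27_holds F k (p + 1) n r hmn hm hn (latinRectangleCondition_prime_add_one hp hodd hkm)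

/-- BILPS Thm 27, unconditional for `m = p - 1`, `p` an odd prime.
[cite: BlaserIkenmeyerLysikovPandeySchreyer2019, Thm. 27 and §7.3 (remarks after Conj. 26)] [cite: Glynn2010AlonTarsi, Thm. 3.2] -/
theorem BILPS2019_thm27_prime_sub_one (F : Type) [Field F] [IsAlgClosed F] [CharZero F]
    {p : ℕ} (hp : p.Prime) (hodd : Odd p) (k n r : ℕ) (hmn : p - 1 ≤ n) (hm : k * r < p - 1)
    (hn : k * r < n) (hkm : k ≤ p - 1) :
    ∃ f : MvPolynomial (Fin k × Fin (p - 1) × Fin n) F, f ≠ 0 ∧ f.IsHomogeneous (k * (p - 1)) ∧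
      ∀ T ∈ (minrankSet F r : Set (Fin k → Fin (p - 1) → Fin n → F)),
        eval (trilinearPt T) f = 0 :=
  BILPS2019_thm27_holds F k (p - 1) n r hmn hm hn (latinRectangleCondition_prime_sub_one hp hodd hkm)

end Literature.Computability.AlgebraicComplexity
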